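import Literature.NumberTheory.Transcendental.NesterenkoEliminationFacts2Proofs
import Mathlib.Algebra.Polynomial.SpecificDegree
import Mathlib.RingTheory.KrullDimension.NonZeroDivisors
import Mathlib.RingTheory.KrullDimension.Polynomial
import Mathlib.RingTheory.KrullDimension.Field
import HarnessLib

/-!
# The degenerate case `deg P = 0` of LNM 1752 Ch. 3 Prop. 4.11 / Cor. 4.12 — a counterexample (proofs only)

`Literature/NumberTheory/Transcendental/NesterenkoEliminationDegenerate.lean` — proofs only (no
named facts; the three `def`s are the concrete data of one example). Proposition 4.11 and
Corollary 4.12 of Nesterenko's "algebraic fundamentals" (Nesterenko–Philippon (eds.), LNM 1752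
(2001), Ch. 3 §4, pp. 40–41) are printed for "a homogeneous polynomial `Q ∉ 𝔭`" (resp. "`P ≠ 0`
homogeneous, `P ∉ 𝔭`"), wording that formally admits the non-zero CONSTANTS. For a constant the
last sentence of either statement (the case `dim 𝔭 = 0`, `r = 1`, "with `|J(ω̄)| = 1`") is false:
with `deg Q = 0`, `h(Q) = 0`, `‖Q‖_ω̄ = 1` it asserts `|𝔭(ω̄)| ≥ 1` as soon as `ρ(ω̄) ≥ 1`
(Prop. 4.11: `0 ≤ log δ`, `δ = |𝔭(ω̄)|` when `ρ ≥ ‖Q‖_ω̄ = 1`; Cor. 4.12: `0 ≤ −S` under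
`|𝔭(ω̄)| ≤ e^{−S}`, `S > 0`, `min(S, log 1/ρ) ≤ 0`). This file PROVES that this fails for

* `m = 1`, `F = x₀² + (3/2) x₀x₁ + x₁² ∈ ℚ[x₀, x₁]` (`cexForm`; irreducible: a monic quadratic in
  `x₀` over `ℚ[x₁]` without roots), `𝔭 = (F)` (`cexIdeal`; prime, homogeneous, `dim 𝔭 = 0`, i.e.
  `IsUnmixedOfRank 𝔭 1`, by `dim ℚ[x₀, x₁]/(F) = 1`), `ω̄ = (0, 1)` (`cexPt`);
* `ρ(ω̄) ≥ 1` (`one_le_rho_cexPt`): a zero `(β₀ : β₁)` of `F` has `|β₁| = |β₀|` (the roots of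
  `t² + (3/2)t + 1` lie on the unit circle), so `‖ω̄ − β‖ = |β₀| / max(|β₀|, |β₁|) = 1`, and
  `V(𝔭) ∋ (1 : (−3 + i√7)/4)` is non-empty;
* `|𝔭(ω̄)| ≤ 2/3` (`iabs_cexIdeal_le`): by `chowForm_span_singleton`
  (`NesterenkoChowFormHypersurface.lean`) the associated form is `c · F(Δ₀, Δ₁)`,
  `Δ = (u₁₁, −u₁₀)`, i.e. `c (u₁₁² − (3/2) u₁₀u₁₁ + u₁₀²)`, of max-coefficient norm `≥ (3/2)|c|`,
  while `ϰ` (Definition 4.6) substitutes `S ω̄ = (s₀₁, 0)` for `(u₁₀, u₁₁)`, so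
  `ϰ(c F(Δ)) = c s₀₁²` has norm `|c|`, and `|ω̄| = 1`;

whence `not_prop_4_11_without_pos_degree` (with `Q = 1`) and `not_cor_4_12_without_pos_degree`
(with `P = 1`, `η = 1`, `S = log (3/2)`): the refutations of the `d`-unrestricted readings of
Proposition 4.11 and Corollary 4.12, i.e. of the encodings (stated verbatim inline) that the named
facts `NesterenkoPhilippon2001_ch3_prop_4_11` (`NesterenkoEliminationFacts2.lean`) and
`NesterenkoPhilippon2001_ch3_cor_4_12` (`NesterenkoEliminationFacts.lean`) had before they were
restated — the reason why both now carry the binder `1 ≤ d`. Both printed statements are used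
(Ch. 3 §5; [Nes10]; Philippon's criterion) and proved ([Nes10, Prop. 1.4, Cor. 3]) only for
`deg ≥ 1`; nothing here bears on that case.

## References

* [NesterenkoPhilippon2001] Yu. V. Nesterenko, P. Philippon (eds.), *Introduction to Algebraic
  Independence Theory*, LNM 1752, Springer 2001, Ch. 3 (Yu. V. Nesterenko) §4, Prop. 4.11,
  Cor. 4.12 (pp. 40–41; PDF pp. 52–53), Definitions 4.3–4.6 (pp. 38–39).
* [Nes10] Yu. V. Nesterenko, Proc. Steklov Inst. Math. 218 (1997) 294–331, Prop. 1.4, Cor. 3.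
-/

noncomputable section

open MvPolynomial
open scoped NNReal

attribute [local instance] MvPolynomial.gradedAlgebra

namespace Literature.NumberTheory.Transcendental

namespace Nesterenko

/-! ### The example: `F = x₀² + (3/2)x₀x₁ + x₁²`, `𝔭 = (F) ⊂ ℚ[x₀, x₁]`, `ω̄ = (0, 1)` -/

/-- The binary quadratic form `F = x₀² + (3/2) x₀ x₁ + x₁² = (2x₀² + 3x₀x₁ + 2x₁²)/2 ∈ ℚ[x₀, x₁]`
(discriminant `9/4 − 4 < 0`; both roots of `F(1, t)` have modulus `1`). [folklore] -/
def cexForm : Rx 1 := X 0 ^ 2 + C (3 / 2) * X 0 * X 1 + X 1 ^ 2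

/-- The principal ideal `𝔭 = (F)` of `ℚ[x₀, x₁]`. [folklore] -/
def cexIdeal : Ideal (Rx 1) := Ideal.span {cexForm}

/-- The point `ω̄ = (0, 1) ∈ ℂ²`. [folklore] -/
def cexPt : Fin (1 + 1) → ℂ := ![0, 1]

/-- The only independent entry `s₀₁` of a skew-symmetric `2 × 2` matrix. [folklore] -/
def s01 : SkewIdx 1 := ⟨((0 : Fin (1 + 1)), 1), by decide⟩

/-- `F` is homogeneous of degree `2`. [folklore] -/
theorem isHomogeneous_cexForm : cexForm.IsHomogeneous 2 := by
  have h1 : (X 0 ^ 2 : Rx 1).IsHomogeneous 2 := isHomogeneous_X_pow _ _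
  have h2 : (C (3 / 2 : ℚ) * X 0 * X 1 : Rx 1).IsHomogeneous 2 :=
    ((isHomogeneous_C _ _).mul (isHomogeneous_X ℚ 0)).mul (isHomogeneous_X ℚ 1)
  have h3 : (X 1 ^ 2 : Rx 1).IsHomogeneous 2 := isHomogeneous_X_pow _ _
  exact (h1.add h2).add h3

/-- `F(0, 1) = 1`. [folklore] -/
theorem aeval_cexPt_cexForm : aeval cexPt cexForm = 1 := by
  simp [cexForm, cexPt]

/-- `F ≠ 0`. [folklore] -/
theorem cexForm_ne_zero : cexForm ≠ 0 := by
  intro h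
  have := aeval_cexPt_cexForm
  rw [h, map_zero] at this
  exact zero_ne_one this

/-- `finSuccEquiv` on constants. [folklore] -/
theorem finSuccEquiv_C_one (a : ℚ) : finSuccEquiv ℚ 1 (C a) = Polynomial.C (C a) := by
  simp [finSuccEquiv_apply]

/-- Under `ℚ[x₀, x₁] ≅ ℚ[x₁][x₀]`, `F` is the monic quadratic `x₀² + (3/2)x₁ · x₀ + x₁²`.
[folklore] -/
theorem finSuccEquiv_cexForm : finSuccEquiv ℚ 1 cexForm =
    Polynomial.C 1 * Polynomial.X ^ 2 + Polynomial.C (C (3 / 2) * X 0) * Polynomial.X +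
      Polynomial.C (X 0 ^ 2) := by
  rw [cexForm, show (X 1 : Rx 1) = X (Fin.succ 0) from rfl]
  simp only [map_add, map_mul, map_pow, finSuccEquiv_X_zero, finSuccEquiv_X_succ,
    finSuccEquiv_C_one, map_one, one_mul]
  ring

/-- The quadratic `x₀² + (3/2)x₁ x₀ + x₁²` has no root in `ℚ[x₁]` (reduce modulo `x₁` twice: a
root `r` has `r ≡ 0`, so `r = x₁ s` and `s² + (3/2)s + 1 ≡ 0 (mod x₁)`, i.e. a rational root of
`s² + (3/2)s + 1`, which has none). [folklore] -/
theorem quadratic_eval_ne_zero (r : MvPolynomial (Fin 1) ℚ) :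
    r ^ 2 + C (3 / 2) * X 0 * r + X 0 ^ 2 ≠ 0 := by
  intro h
  -- reduction modulo `x₁`: the constant coefficient
  have h1 : constantCoeff r = 0 := by
    have h' := congrArg constantCoeff h
    simp only [map_add, map_mul, map_pow, constantCoeff_C, constantCoeff_X, mul_zero, zero_mul,
      add_zero, map_zero, zero_pow two_ne_zero] at h'
    exact pow_eq_zero_iff two_ne_zero |>.mp h'
  -- hence `r = x₁ · s`
  have hdvd : (X 0 : MvPolynomial (Fin 1) ℚ) ∣ r := by
    have key : ∀ p : MvPolynomial (Fin 1) ℚ,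
        (X 0 : MvPolynomial (Fin 1) ℚ) ∣ p - C (constantCoeff p) := by
      intro p
      induction p using MvPolynomial.induction_on with
      | C a => simp
      | add p q hp hq =>
          rw [map_add, map_add, add_sub_add_comm]
          exact dvd_add hp hq
      | mul_X p i hp =>
          obtain rfl : i = 0 := Subsingleton.elim i 0
          rw [map_mul, constantCoeff_X, mul_zero, map_zero, sub_zero]
          exact dvd_mul_left _ _
    simpa [h1] using key r
  obtain ⟨s, rfl⟩ := hdvd
  have h2 : (X 0 : MvPolynomial (Fin 1) ℚ) ^ 2 * (s ^ 2 + C (3 / 2) * s + 1) = 0 := by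
    rw [← h]; ring
  rcases mul_eq_zero.mp h2 with h0 | h3
  · exact X_ne_zero (0 : Fin 1) (pow_eq_zero_iff two_ne_zero |>.mp h0)
  · have h' := congrArg constantCoeff h3
    simp only [map_add, map_mul, map_pow, constantCoeff_C, map_one, map_zero] at h'
    nlinarith [sq_nonneg (constantCoeff s + 3 / 4)]

/-- **`F` is irreducible** over `ℚ`: under `ℚ[x₀, x₁] ≅ ℚ[x₁][x₀]` it is a monic quadratic
without roots (Mathlib `Monic.irreducible_iff_roots_eq_zero_of_degree_le_three`). [folklore] -/
theorem irreducible_cexForm : Irreducible cexForm := by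
  rw [← MulEquiv.irreducible_iff (finSuccEquiv ℚ 1), finSuccEquiv_cexForm]
  have hmonic : (Polynomial.C 1 * Polynomial.X ^ 2 + Polynomial.C (C (3 / 2) * X 0) * Polynomial.X +
      Polynomial.C (X 0 ^ 2) : Polynomial (MvPolynomial (Fin 1) ℚ)).Monic := by
    rw [Polynomial.Monic, Polynomial.leadingCoeff_quadratic one_ne_zero]
  have hdeg : (Polynomial.C 1 * Polynomial.X ^ 2 + Polynomial.C (C (3 / 2) * X 0) * Polynomial.X +
      Polynomial.C (X 0 ^ 2) : Polynomial (MvPolynomial (Fin 1) ℚ)).natDegree = 2 :=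
    Polynomial.natDegree_quadratic one_ne_zero
  rw [hmonic.irreducible_iff_roots_eq_zero_of_degree_le_three (by omega) (by omega),
    Multiset.eq_zero_iff_forall_notMem]
  intro r hr
  rw [Polynomial.mem_roots hmonic.ne_zero, Polynomial.IsRoot.def] at hr
  simp only [Polynomial.eval_add, Polynomial.eval_mul, Polynomial.eval_pow, Polynomial.eval_C,
    Polynomial.eval_X, one_mul] at hr
  exact quadratic_eval_ne_zero r (by linear_combination hr)

/-- `𝔭 = (F)` is a prime ideal. [folklore] -/
theorem isPrime_cexIdeal : cexIdeal.IsPrime :=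
  (Ideal.span_singleton_prime cexForm_ne_zero).mpr
    (UniqueFactorizationMonoid.irreducible_iff_prime.mp irreducible_cexForm)

/-- `𝔭 = (F)` is a homogeneous ideal. [folklore] -/
theorem isHomogeneous_cexIdeal : cexIdeal.IsHomogeneous (homogeneousSubmodule (Fin (1 + 1)) ℚ) :=
  Ideal.homogeneous_span _ _ fun x hx => by
    rw [Set.mem_singleton_iff] at hx
    subst hx
    exact ⟨2, (mem_homogeneousSubmodule 2 _).mpr isHomogeneous_cexForm⟩

/-- `x₀ ∉ (F)` (degrees). [folklore] -/
theorem X_zero_not_mem_cexIdeal : (X 0 : Rx 1) ∉ cexIdeal := by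
  intro h
  obtain ⟨q, hq⟩ := Ideal.mem_span_singleton.mp h
  have hq0 : q ≠ 0 := by
    rintro rfl
    rw [mul_zero] at hq
    exact X_ne_zero _ hq
  have h1 := congrArg totalDegree hq
  rw [totalDegree_X, totalDegree_mul_of_isDomain cexForm_ne_zero hq0,
    isHomogeneous_cexForm.totalDegree cexForm_ne_zero] at h1
  omega

/-- `dim ℚ[x₀, x₁]/(F) = 1`, i.e. `dim 𝔭 = 0` projectively. [folklore] -/
theorem ringKrullDim_quotient_cexIdeal : ringKrullDim (Rx 1 ⧸ cexIdeal) = (1 : ℕ) := by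
  haveI := isPrime_cexIdeal
  apply le_antisymm
  · -- `≤`: `F` is a non-zero-divisor in the two-dimensional ring `ℚ[x₀, x₁]`
    have hdim : ringKrullDim (Rx 1) = (1 + 1 : ℕ) := by
      rw [MvPolynomial.ringKrullDim_of_isNoetherianRing, ringKrullDim_eq_zero_of_field]
      simp
    refine ENat.WithBot.add_le_add_one_right_iff.mp ?_
    have := ringKrullDim_quotient_succ_le_of_nonZeroDivisor
      (mem_nonZeroDivisors_of_ne_zero cexForm_ne_zero)
    rw [hdim] at this
    exact_mod_cast this
  · -- `≥`: the chain `(0) < (x₀, x₁)/(F)` of primes in the domain `ℚ[x₀, x₁]/(F)`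
    rw [ringKrullDim, Nat.cast_one, Order.one_le_krullDim_iff]
    set 𝔪 : Ideal (Rx 1) := RingHom.ker (eval (0 : Fin (1 + 1) → ℚ)) with h𝔪
    have h𝔪prime : 𝔪.IsPrime := RingHom.ker_isPrime _
    have hle : cexIdeal ≤ 𝔪 := by
      rw [cexIdeal, Ideal.span_singleton_le_iff_mem, h𝔪, RingHom.mem_ker]
      simp [cexForm]
    have hker : RingHom.ker (Ideal.Quotient.mk cexIdeal) ≤ 𝔪 := by rwa [Ideal.mk_ker]
    have hP : (𝔪.map (Ideal.Quotient.mk cexIdeal)).IsPrime :=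
      Ideal.map_isPrime_of_surjective Ideal.Quotient.mk_surjective hker
    refine ⟨⟨⊥, Ideal.isPrime_bot⟩, ⟨_, hP⟩, ?_⟩
    rw [← PrimeSpectrum.asIdeal_lt_asIdeal]
    change (⊥ : Ideal (Rx 1 ⧸ cexIdeal)) < 𝔪.map (Ideal.Quotient.mk cexIdeal)
    rw [bot_lt_iff_ne_bot]
    intro hbot
    have hX : Ideal.Quotient.mk cexIdeal (X 0) ∈ 𝔪.map (Ideal.Quotient.mk cexIdeal) := by
      apply Ideal.mem_map_of_mem
      rw [h𝔪, RingHom.mem_ker, eval_X]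
      rfl
    rw [hbot, Ideal.mem_bot, Ideal.Quotient.eq_zero_iff_mem] at hX
    exact X_zero_not_mem_cexIdeal hX

/-- `𝔭 = (F)` is unmixed with `dim 𝔭 = 0` (`r = 1`). [folklore] -/
theorem isUnmixedOfRank_cexIdeal : IsUnmixedOfRank cexIdeal 1 :=
  isUnmixedOfRank_of_isPrime isPrime_cexIdeal ringKrullDim_quotient_cexIdeal

/-! ### The point `ω̄ = (0, 1)`: `|ω̄| = 1`, `‖1‖_ω̄ = 1`, `h(1) = 0` -/

/-- `ω̄ ≠ 0`. [folklore] -/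
theorem cexPt_ne_zero : cexPt ≠ 0 := by
  intro h
  have := congrFun h 1
  simp [cexPt] at this

/-- `|ω̄| = 1`. [folklore] -/
theorem norm_cexPt : ‖cexPt‖ = 1 := by
  apply le_antisymm
  · refine (pi_norm_le_iff_of_nonneg zero_le_one).mpr fun i => ?_
    fin_cases i <;> simp [cexPt]
  · have := norm_le_pi_norm cexPt 1
    simpa [cexPt] using this

/-- `|1| = 1` for the maximum-of-coefficients norm. [folklore] -/
theorem maxNorm_one {σ K : Type*} [NormedField K] : maxNorm (1 : MvPolynomial σ K) = 1 := by
  refine le_antisymm maxNorm_one_le ?_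
  have := norm_coeff_le_maxNorm (1 : MvPolynomial σ K) 0
  rwa [coeff_zero_one, norm_one] at this

/-- `‖1‖_ω̄ = 1`. [folklore] -/
theorem normAt_cexPt_one : normAt cexPt (1 : Rx 1) = 1 := by
  rw [normAt, map_one, norm_one, maxNorm_one, totalDegree_one, pow_zero, mul_one, div_one]

/-- `h(1) = 0` (the height of Definition 4.2 of the constant polynomial `1`). [folklore] -/
theorem height_one {σ : Type*} : height (1 : MvPolynomial σ ℚ) = 0 := by
  classical
  have h : (fun γ : (1 : MvPolynomial σ ℚ).support => (1 : MvPolynomial σ ℚ).coeff γ) = 1 := by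
    funext γ
    obtain ⟨γ, hγ⟩ := γ
    have hc := mem_support_iff.mp hγ
    rw [coeff_one] at hc ⊢
    split_ifs at hc with h0
    · simp [h0]
    · exact absurd rfl hc
  rw [height, h, Height.logHeight_one]

/-! ### The zeros of `𝔭`: `ρ(ω̄) ≥ 1` -/

/-- If `u² + (3/2)uv + v² = 0` then `|v| = |u|` (the roots of `t² + (3/2)t + 1` lie on the unit
circle). [folklore] -/
theorem norm_eq_norm_of_quadratic {u v : ℂ} (h : u ^ 2 + 3 / 2 * u * v + v ^ 2 = 0) :
    ‖v‖ = ‖u‖ := by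
  by_cases hu : u = 0
  · subst hu
    have hv : v = 0 := by simpa using h
    rw [hv]
  · set s : ℂ := v / u with hs
    have hv : v = s * u := by rw [hs]; field_simp
    have h2 : u ^ 2 * (2 * s ^ 2 + 3 * s + 2) = 0 := by
      rw [hv] at h
      linear_combination 2 * h
    have h3 : 2 * s ^ 2 + 3 * s + 2 = 0 := by
      rcases mul_eq_zero.mp h2 with h0 | h0
      · exact absurd (pow_eq_zero_iff two_ne_zero |>.mp h0) hu
      · exact h0
    have hre := congrArg Complex.re h3
    have him := congrArg Complex.im h3
    simp only [Complex.add_re, Complex.mul_re, Complex.re_ofNat, Complex.im_ofNat, zero_mul,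
      sub_zero, Complex.zero_re, Complex.add_im, Complex.mul_im, add_zero, Complex.zero_im,
      pow_two] at hre him
    have hnorm : ‖s‖ = 1 := by
      have hsq : s.re * s.re + s.im * s.im = 1 := by
        have him' : s.im * (4 * s.re + 3) = 0 := by linear_combination him
        rcases mul_eq_zero.mp him' with h0 | h0
        · rw [h0] at hre
          nlinarith [sq_nonneg (4 * s.re + 3)]
        · have hx : s.re = -3 / 4 := by linarith
          rw [hx] at hre ⊢
          nlinarith [hre]
      have : ‖s‖ ^ 2 = 1 := by rw [Complex.sq_norm, Complex.normSq_apply]; exact hsq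
      nlinarith [norm_nonneg s]
    rw [hv, norm_mul, hnorm, one_mul]

/-- A zero `β` of `𝔭` has `F(β) = β₀² + (3/2)β₀β₁ + β₁² = 0`. [folklore] -/
theorem quadratic_of_mem_projZeros {β : Fin (1 + 1) → ℂ} (hβ : β ∈ projZeros cexIdeal) :
    β 0 ^ 2 + 3 / 2 * β 0 * β 1 + β 1 ^ 2 = 0 := by
  have h := hβ.2 cexForm (Ideal.subset_span rfl)
  simpa [cexForm, map_ofNat] using h

/-- Every zero `β` of `𝔭` is at projective distance `1` from `ω̄ = (0, 1)`:
`‖ω̄ − β‖ = |β₀| / (|ω̄| max(|β₀|, |β₁|)) = 1` as `|β₁| = |β₀|`. [folklore] -/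
theorem projDist_cexPt_eq_one {β : Fin (1 + 1) → ℂ} (hβ : β ∈ projZeros cexIdeal) :
    projDist cexPt β = 1 := by
  have hn : ‖β 1‖ = ‖β 0‖ := norm_eq_norm_of_quadratic (quadratic_of_mem_projZeros hβ)
  have hβ0 : β 0 ≠ 0 := by
    intro h0
    apply hβ.1
    funext i
    fin_cases i
    · exact h0
    · simpa [h0] using hn
  have hnormβ : ‖β‖ = ‖β 0‖ := by
    apply le_antisymm
    · refine (pi_norm_le_iff_of_nonneg (norm_nonneg _)).mpr fun i => ?_
      fin_cases i
      · exact le_rfl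
      · exact hn.le
    · exact norm_le_pi_norm β 0
  have hsup : (Finset.univ.sup fun p : SkewIdx 1 =>
      ‖cexPt p.1.1 * β p.1.2 - cexPt p.1.2 * β p.1.1‖₊) = ‖β 0‖₊ := by
    have hval : ∀ p : SkewIdx 1, ‖cexPt p.1.1 * β p.1.2 - cexPt p.1.2 * β p.1.1‖₊ = ‖β 0‖₊ := by
      rintro ⟨⟨a, b⟩, hab⟩
      fin_cases a <;> fin_cases b <;> simp [cexPt] at hab ⊢
    apply le_antisymm
    · exact Finset.sup_le fun p _ => (hval p).le
    · have := Finset.le_sup (f := fun p : SkewIdx 1 =>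
        ‖cexPt p.1.1 * β p.1.2 - cexPt p.1.2 * β p.1.1‖₊) (Finset.mem_univ s01)
      rwa [hval] at this
  rw [projDist, hsup, norm_cexPt, one_mul, hnormβ, coe_nnnorm]
  exact div_self (norm_ne_zero_iff.mpr hβ0)

/-- The root `t = (−3 + i√7)/4` of `t² + (3/2)t + 1`. [folklore] -/
def cexRoot : ℂ := ⟨-3 / 4, Real.sqrt 7 / 4⟩

/-- `2t² + 3t + 2 = 0`. [folklore] -/
theorem cexRoot_spec : 2 * cexRoot ^ 2 + 3 * cexRoot + 2 = 0 := by
  have h7 : Real.sqrt 7 * Real.sqrt 7 = 7 := Real.mul_self_sqrt (by norm_num)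
  apply Complex.ext
  · simp only [Complex.add_re, Complex.mul_re, Complex.re_ofNat, Complex.im_ofNat, zero_mul,
      sub_zero, pow_two, cexRoot, Complex.zero_re]
    nlinarith [h7]
  · simp only [Complex.add_im, Complex.mul_im, Complex.re_ofNat, Complex.im_ofNat, zero_mul,
      add_zero, pow_two, cexRoot, Complex.zero_im, Complex.mul_re]
    ring

/-- `(1 : t)` is a zero of `𝔭`. [folklore] -/
theorem cons_cexRoot_mem_projZeros : (![1, cexRoot] : Fin (1 + 1) → ℂ) ∈ projZeros cexIdeal := by
  refine ⟨fun h => ?_, fun P hP => ?_⟩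
  · have := congrFun h 0
    simp at this
  · obtain ⟨q, rfl⟩ := Ideal.mem_span_singleton.mp hP
    have hF : aeval (![1, cexRoot] : Fin (1 + 1) → ℂ) cexForm = 0 := by
      have := cexRoot_spec
      simp only [cexForm, map_add, map_mul, map_pow, aeval_X, aeval_C, Matrix.cons_val_zero,
        Matrix.cons_val_one, one_pow, mul_one, map_div₀, map_ofNat]
      linear_combination (1 / 2 : ℂ) * this
    rw [map_mul, hF, zero_mul]

/-- **`ρ(ω̄) ≥ 1`**: the distance from `ω̄ = (0, 1)` to `V(𝔭)` (two points, both at projective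
distance `1`). [folklore] -/
theorem one_le_rho_cexPt : 1 ≤ rho cexPt cexIdeal := by
  refine le_csInf ⟨_, _, cons_cexRoot_mem_projZeros, rfl⟩ ?_
  rintro _ ⟨β, hβ, rfl⟩
  exact (projDist_cexPt_eq_one hβ).ge

/-! ### The associated form of `𝔭` and `|𝔭(ω̄)| ≤ 2/3` -/

/-- `Δ₀ = u₁₁` for the generic `1 × 2` matrix. [folklore] -/
theorem genDelta_one_zero : genDelta 1 0 = X (0, 1) := by
  rw [genDelta, maxMinor, Matrix.det_fin_one]
  simp [Matrix.mvPolynomialX_apply]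

/-- `Δ₁ = −u₁₀` for the generic `1 × 2` matrix. [folklore] -/
theorem genDelta_one_one : genDelta 1 1 = -X (0, 0) := by
  rw [genDelta, maxMinor, Matrix.det_fin_one]
  simp [Matrix.mvPolynomialX_apply]

/-- `F(Δ₀, Δ₁) = u₁₁² − (3/2) u₁₀ u₁₁ + u₁₀²`. [folklore] -/
theorem hyperChow_cexForm : hyperChow cexForm =
    X (0, 1) ^ 2 - C (3 / 2) * (X (0, 0) * X (0, 1)) + X (0, 0) ^ 2 := by
  rw [hyperChow, cexForm]
  simp only [map_add, map_mul, map_pow, aeval_X, aeval_C, genDelta_one_zero, genDelta_one_one,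
    algebraMap_eq]
  ring

/-- `ϰ` substitutes `S ω̄ = (s₀₁, 0)` for `u₁ = (u₁₀, u₁₁)` when `ω̄ = (0, 1)`: on `u₁₀`.
[folklore] -/
theorem kappa_cexPt_X_zero :
    kappa cexPt (X ((0 : Fin 1), (0 : Fin (1 + 1))) : RU 1 1) = X (0, s01) := by
  rw [kappa, aeval_X, Fin.sum_univ_two]
  simp [skewEntry, cexPt, s01]

/-- `ϰ` on `u₁₁` (for `ω̄ = (0, 1)`): `(S ω̄)₁ = s₁₁ = 0`. [folklore] -/
theorem kappa_cexPt_X_one : kappa cexPt (X ((0 : Fin 1), (1 : Fin (1 + 1))) : RU 1 1) = 0 := by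
  rw [kappa, aeval_X, Fin.sum_univ_two]
  simp [skewEntry, cexPt]

/-- `ϰ(F(Δ)) = s₀₁²`. [folklore] -/
theorem kappa_cexPt_hyperChow : kappa cexPt (hyperChow cexForm) = X (0, s01) ^ 2 := by
  have h0 := kappa_cexPt_X_zero
  have h1 := kappa_cexPt_X_one
  rw [kappa] at h0 h1 ⊢
  rw [hyperChow_cexForm]
  simp only [map_add, map_sub, map_mul, map_pow, h0, h1]
  ring

/-- The exponent `u₁₀ u₁₁`. [folklore] -/
def e01 : Fin 1 × Fin (1 + 1) →₀ ℕ := Finsupp.single (0, 0) 1 + Finsupp.single (0, 1) 1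

/-- The coefficient of `u₁₀ u₁₁` in `F(Δ)` is `−3/2`. [folklore] -/
theorem coeff_e01_hyperChow : (hyperChow cexForm).coeff e01 = -(3 / 2) := by
  have hne1 : Finsupp.single ((0 : Fin 1), (1 : Fin (1 + 1))) 2 ≠ e01 := by
    intro h
    have := DFunLike.congr_fun h (0, 0)
    simp [e01] at this
  have hne0 : Finsupp.single ((0 : Fin 1), (0 : Fin (1 + 1))) 2 ≠ e01 := by
    intro h
    have := DFunLike.congr_fun h (0, 1)
    simp [e01] at this
  have hmul : (X (0, 0) * X (0, 1) : RU 1 1) = monomial e01 1 := by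
    rw [e01, X, X, monomial_mul, one_mul]
  rw [hyperChow_cexForm, coeff_add, coeff_sub, X_pow_eq_monomial, X_pow_eq_monomial, hmul,
    coeff_monomial, coeff_monomial, coeff_C_mul, coeff_monomial, if_neg hne1, if_neg hne0,
    if_pos rfl]
  norm_num

/-- **`|𝔭(ω̄)| ≤ 2/3`** for `𝔭 = (F)`, `ω̄ = (0, 1)`: the associated form is `c · F(Δ)`,
`ϰ(F(Δ)) = s₀₁²` has `|ϰ| = |c|`, while `|c F(Δ)| ≥ (3/2)|c|`. [folklore] -/
theorem iabs_cexIdeal_le : iabs cexIdeal 1 cexPt ≤ 2 / 3 := by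
  obtain ⟨c, hc, hcf⟩ := chowForm_span_singleton isHomogeneous_cexForm two_pos
  have hcpos : 0 < ‖c‖ := norm_pos_iff.mpr hc
  -- numerator `|ϰ(c F(Δ))| = |c|`
  have hnum : maxNorm (kappa cexPt (chowForm cexIdeal 1)) = ‖c‖ := by
    have hmul : kappa cexPt (C c * hyperChow cexForm) =
        C (c : ℂ) * kappa cexPt (hyperChow cexForm) := by
      rw [kappa, map_mul]
      change kappa cexPt (C c) * kappa cexPt (hyperChow cexForm) = _
      rw [kappa_C]
    rw [cexIdeal, hcf, hmul, kappa_cexPt_hyperChow, maxNorm_C_mul, norm_ratCast_eq,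
      X_pow_eq_monomial]
    have h1 : maxNorm (monomial (Finsupp.single ((0 : Fin 1), s01) 2) (1 : ℂ)) = 1 := by
      refine le_antisymm ((maxNorm_monomial_le _ _).trans (by rw [norm_one])) ?_
      have := norm_coeff_le_maxNorm (monomial (Finsupp.single ((0 : Fin 1), s01) 2) (1 : ℂ))
        (Finsupp.single (0, s01) 2)
      rwa [coeff_monomial, if_pos rfl, norm_one] at this
    rw [h1, mul_one]
  -- denominator `|c F(Δ)| ≥ (3/2)|c|`
  have hden : 3 / 2 * ‖c‖ ≤ maxNorm (chowForm cexIdeal 1) := by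
    rw [cexIdeal, hcf, maxNorm_C_mul]
    have := norm_coeff_le_maxNorm (hyperChow cexForm) e01
    have h32 : ‖(-(3 / 2) : ℚ)‖ = 3 / 2 := by
      rw [norm_neg, ← Rat.norm_cast_real, Real.norm_eq_abs]; push_cast; norm_num
    rw [coeff_e01_hyperChow, h32] at this
    nlinarith [this, hcpos]
  rw [iabs, hnum, norm_cexPt, one_pow, mul_one,
    div_le_iff₀ (by linarith : 0 < maxNorm (chowForm cexIdeal 1))]
  linarith

/-! ### The refutations -/

/-- **The `d`-unrestricted reading of LNM 1752 Ch. 3 Corollary 4.12 is false.** The encoding of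
Corollary 4.12 that allows `deg P = 0` (the statement as printed: "`P ≠ 0` homogeneous,
`P ∉ 𝔭`") fails for `m = 1`, `𝔭 = (x₀² + (3/2)x₀x₁ + x₁²)`, `ω̄ = (0, 1)`, `P = 1`, `η = 1`,
`S = log (3/2)`: all hypotheses hold (`|𝔭(ω̄)| ≤ 2/3 = e^{−S}`, `‖1‖_ω̄ = 1`,
`1 ≤ max(e^{−S}, ρ)²` as `ρ(ω̄) ≥ 1`) while the conclusion for `dim 𝔭 = 0` reads
`1 ≤ exp(−S + 0) = 2/3`. This is why the tree's named fact
`NesterenkoPhilippon2001_ch3_cor_4_12` carries `1 ≤ d`.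
[cite: NesterenkoPhilippon2001, Ch. 3 Cor. 4.12 (p. 41)] -/
theorem not_cor_4_12_without_pos_degree :
    ¬ (∀ (m r : ℕ) (𝔭 : Ideal (Rx m)) (P : Rx m) (d : ℕ), 1 ≤ r → r ≤ m → 𝔭.IsPrime →
      𝔭.IsHomogeneous (homogeneousSubmodule (Fin (m + 1)) ℚ) → IsUnmixedOfRank 𝔭 r →
      P ≠ 0 → P.IsHomogeneous d → P ∉ 𝔭 →
      ∀ (ω : Fin (m + 1) → ℂ) (S : ℝ) (η : ℕ), ω ≠ 0 → 0 < S → 0 < η →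
        iabs 𝔭 r ω ≤ Real.exp (-S) →
        normAt ω P ≤ Real.exp (-(2 * (m : ℝ) * d)) →
        normAt ω P ^ η ≤ max (Real.exp (-S)) (rho ω 𝔭) ^ 2 →
        (2 ≤ r → ∃ J : Ideal (Rx m),
            J.IsHomogeneous (homogeneousSubmodule (Fin (m + 1)) ℚ) ∧ IsUnmixedOfRank J (r - 1) ∧
            projZeros J = projZeros (𝔭 ⊔ Ideal.span {P}) ∧
            ideg J (r - 1) ≤ η * ideg 𝔭 r * d ∧
            iheight J (r - 1) ≤ η * (iheight 𝔭 r * d + height P * ideg 𝔭 r +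
              (m : ℝ) * (r + 2) * d * ideg 𝔭 r) ∧
            iabs J (r - 1) ω ≤ Real.exp (-S + η * (iheight 𝔭 r * d + height P * ideg 𝔭 r +
              12 * (m : ℝ) ^ 2 * d * ideg 𝔭 r))) ∧
        (r = 1 → (1 : ℝ) ≤ Real.exp (-S + η * (iheight 𝔭 r * d + height P * ideg 𝔭 r +
              12 * (m : ℝ) ^ 2 * d * ideg 𝔭 r)))) := by
  intro h
  have hnot : (1 : Rx 1) ∉ cexIdeal := fun h1 =>
    isPrime_cexIdeal.ne_top ((Ideal.eq_top_iff_one _).mpr h1)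
  have hS : 0 < Real.log (3 / 2) := Real.log_pos (by norm_num)
  have hexp : Real.exp (-Real.log (3 / 2)) = 2 / 3 := by
    rw [Real.exp_neg, Real.exp_log (by norm_num)]; norm_num
  have h1 : iabs cexIdeal 1 cexPt ≤ Real.exp (-Real.log (3 / 2)) := hexp ▸ iabs_cexIdeal_le
  have h2 : normAt cexPt (1 : Rx 1) ≤ Real.exp (-(2 * ((1 : ℕ) : ℝ) * ((0 : ℕ) : ℝ))) := by
    rw [normAt_cexPt_one]; simp
  have h3 : normAt cexPt (1 : Rx 1) ^ 1 ≤
      max (Real.exp (-Real.log (3 / 2))) (rho cexPt cexIdeal) ^ 2 := by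
    rw [normAt_cexPt_one, one_pow]
    exact one_le_pow₀ (le_max_of_le_right one_le_rho_cexPt)
  have := (h 1 1 cexIdeal 1 0 le_rfl le_rfl isPrime_cexIdeal isHomogeneous_cexIdeal
    isUnmixedOfRank_cexIdeal one_ne_zero (isHomogeneous_one _ _) hnot cexPt (Real.log (3 / 2)) 1
    cexPt_ne_zero hS one_pos h1 h2 h3).2 rfl
  simp only [height_one, Nat.cast_zero, Nat.cast_one, mul_zero, zero_mul, add_zero] at this
  rw [hexp] at this
  norm_num at this

/-- **The `d`-unrestricted reading of LNM 1752 Ch. 3 Proposition 4.11 is false** (its last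
sentence, the case `r = 1`, with `Q = 1`): for `m = 1`, `𝔭 = (x₀² + (3/2)x₀x₁ + x₁²)`,
`ω̄ = (0, 1)` one has `ρ(ω̄) ≥ 1 = ‖1‖_ω̄`, so `δ = |𝔭(ω̄)| ≤ 2/3`, and the printed inequality
`0 ≤ log δ + h(Q) deg 𝔭 + h(𝔭) deg Q + 11 m² deg 𝔭 deg Q = log δ` fails. As for Corollary 4.12,
the printed wording ("`Q` homogeneous, `Q ∉ 𝔭`") lets in the constants; the proposition needs
`deg Q ≥ 1`. The proposition refuted here is, verbatim, the encoding that the named fact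
`NesterenkoPhilippon2001_ch3_prop_4_11` (`NesterenkoEliminationFacts2.lean`) had before it was
restated with the binder `1 ≤ d` — the reason for that binder.
[cite: NesterenkoPhilippon2001, Ch. 3 Prop. 4.11 (pp. 40–41)] -/
theorem not_prop_4_11_without_pos_degree :
    ¬ (∀ (m r : ℕ) (𝔭 : Ideal (Rx m)) (Q : Rx m) (d : ℕ), 1 ≤ r → r ≤ m → 𝔭.IsPrime →
      𝔭.IsHomogeneous (homogeneousSubmodule (Fin (m + 1)) ℚ) → IsUnmixedOfRank 𝔭 r →
      Q.IsHomogeneous d → Q ∉ 𝔭 →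
        (2 ≤ r → ∃ J : Ideal (Rx m),
            J.IsHomogeneous (homogeneousSubmodule (Fin (m + 1)) ℚ) ∧ IsUnmixedOfRank J (r - 1) ∧
            projZeros J = projZeros (𝔭 ⊔ Ideal.span {Q}) ∧
            ideg J (r - 1) ≤ ideg 𝔭 r * d ∧
            iheight J (r - 1) ≤
              iheight 𝔭 r * d + height Q * ideg 𝔭 r + (m : ℝ) * (r + 1) * ideg 𝔭 r * d ∧
            ∀ ω : Fin (m + 1) → ℂ, ω ≠ 0 →
              iabs J (r - 1) ω ≤ bezoutDelta 𝔭 r Q ω *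
                Real.exp (height Q * ideg 𝔭 r + iheight 𝔭 r * d +
                  11 * (m : ℝ) ^ 2 * ideg 𝔭 r * d)) ∧
        (r = 1 → ∀ ω : Fin (m + 1) → ℂ, ω ≠ 0 →
            (1 : ℝ) ≤ bezoutDelta 𝔭 r Q ω *
              Real.exp (height Q * ideg 𝔭 r + iheight 𝔭 r * d +
                11 * (m : ℝ) ^ 2 * ideg 𝔭 r * d))) := by
  intro h
  have hnot : (1 : Rx 1) ∉ cexIdeal := fun h1 =>
    isPrime_cexIdeal.ne_top ((Ideal.eq_top_iff_one _).mpr h1)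
  have := (h 1 1 cexIdeal 1 0 le_rfl le_rfl isPrime_cexIdeal isHomogeneous_cexIdeal
    isUnmixedOfRank_cexIdeal (isHomogeneous_one _ _) hnot).2 rfl cexPt cexPt_ne_zero
  rw [height_one, bezoutDelta_of_le (by rw [normAt_cexPt_one]; exact one_le_rho_cexPt)] at this
  simp only [Nat.cast_zero, Nat.cast_one, mul_zero, zero_mul, add_zero, Real.exp_zero,
    mul_one] at this
  have hle := iabs_cexIdeal_le
  linarith

end Nesterenko

end Literature.NumberTheory.Transcendental

end
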